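import Summits.Langlands.Langlands.Theorems.IrreducibilityBySelfDualityReciprocityUpToIrreducibilityAboveUnramified
import HarnessLib

/-!
# Line `Sketch` for the crux `ReciprocityUpToIrreducibility` (item stmt-Langlands-14328), continuation c4:
# the disprover's witness pair `(π_𝟙, ρ = 1)` CORRESPONDS, for every reciprocity datum

Support file (closes nothing; registered stub `stub_trivialPair_corresponds_of_inertiaCharacter` of line
`Sketch`, continuation lead c4, prover-line-stmt-Langlands-14328-c4-0).

The crux's disprover (cdisprove cycle 1) used the pair `π_𝟙 = ℂ·(1 ∘ det)/⊥` (the trivial automorphic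
character of `GL₁(𝔸_K)`) and `ρ = 1 : Γ_K → GL₁(ℚ̄_ℓ)` as a witness that the tree could not decide the
summit's predicate `Corresponds Rec ι π ρ` for ANY pair: at `v ∣ ℓ` the pinned Fontaine datum was
unpinned (settled by c3 after clause (F8): `localGlobalCompatibleAt_trivial_above`), and at `v ∤ ℓ` the
Grothendieck–Deligne relation `IsWeilDeligneOfLadic` demands a character `t : I_{K_v} →* ℚ̄_ℓ`
non-trivial on an open subgroup of inertia, of which the tree had no producer.  Granted such a
character at every `v ∤ ℓ` (hypothesis; the lead discharges it by a Literature theorem), this file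
proves `Corresponds Rec ι π_𝟙 1` for EVERY reciprocity datum `Rec`:

* `isTransportAlong_trivial`, `isWeilDeligneOfLadic_one_trivial`,
  `hasFrobSemisimpleClass_trivial_recGL_one` — local bookkeeping: the trivial Weil–Deligne
  representation transports to the trivial one, is attached to the trivial `ρW` by the
  Grothendieck–Deligne recipe (`IsWeilDeligneOfLadic.of_N_eq_zero` with `U = I_F`), and is the class
  `rec_1(1 ∘ det)` of every local Langlands datum (`gl_one`).
* `hasLocalComponentAt_trivial` — the local component of `π_𝟙` at `v` is the trivial character.
* `eventually_satakeFrobCompatibleAt_trivial` — Satake parameter `{1}` a.e.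
  (`AutomorphicRepData.hasSatakeParamAt_detTwist_glOne`) against `char(Frob_v) = X - 1`.
* `localGlobalCompatibleAt_trivial_away` — the `v ∤ ℓ` clause for `(π_𝟙, 1)`.
* `corresponds_trivial` / `stub_trivialPair_corresponds_of_inertiaCharacter` — the registered stub.

No definitions; standard axioms only.
-/

noncomputable section

set_option linter.dupNamespace false -- project-wide option (lakefile weak.linter.dupNamespace); `Summit.Langlands.Langlands` is the mandated namespace

open scoped MatrixGroups Matrix NumberField Classical
open Filter IsDedekindDomain Field
open Literature.NumberTheory.Automorphic Literature.NumberTheory.GaloisRepresentations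
open Literature.NumberTheory.PAdicHodge
open Summit.Langlands

namespace Summit.Langlands.Langlands.Theorems.ReciprocityUpToIrreducibility

/-! ## 1. Local bookkeeping: the trivial Weil–Deligne representation -/

section Local

variable {F : Type} [Field F] [ValuativeRel F] [TopologicalSpace F] [IsNonarchimedeanLocalField F]
  {E : Type*} [Field E] [CharZero E] {C : Type*} [Field C] [CharZero C] {n : ℕ}

/-- The trivial Weil–Deligne representation on `Eⁿ` transports along any `ι : E →+* C` to the
trivial Weil–Deligne representation on `Cⁿ` (`ι(1) = 1`, `ι(0) = 0` entrywise).
[cite: DeligneAntwerpII1973, §8.4.3] -/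
theorem isTransportAlong_trivial (ι : E →+* C) :
    (WeilDeligneRep.trivial E (Fin n → E) : WeilDeligneRep F E (Fin n → E)).IsTransportAlong ι
      (WeilDeligneRep.trivial C (Fin n → C)) := by
  refine ⟨fun w => ?_, ?_⟩
  · simp [WeilDeligneRep.trivial, Representation.trivial, Matrix.map_one _ (map_zero _) (map_one _)]
  · simp [WeilDeligneRep.trivial, Matrix.map_zero _ (map_zero _)]

/-- **Grothendieck–Deligne for the trivial representation.**  Granted a character
`t : I_F →* E` (multiplicatively written) which is not identically `1`, the trivial Weil–Deligne
representation `(1, N = 0)` on `Eⁿ` is attached by the Grothendieck–Deligne recipe to the trivial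
homomorphism `W_F → GL_n(E)`: take `U = I_F` (open, `WeilGroup.isOpen_inertia`), the given `t`, and
any geometric Frobenius `Φ` (`WeilGroup.deg_surjective`); with `N = 0` both `exp` factors are `1`
(`IsWeilDeligneOfLadic.of_N_eq_zero`). [cite: TateCorvallis1979, (4.1.3)–(4.2.1)]
[cite: DeligneAntwerpII1973, §8.4.2] -/
theorem isWeilDeligneOfLadic_one_trivial (t : WeilGroup.inertia F →* Multiplicative E)
    (ht : ∃ u : WeilGroup.inertia F, t u ≠ 1) :
    IsWeilDeligneOfLadic (1 : WeilGroup F →* GL (Fin n) E)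
      (WeilDeligneRep.trivial E (Fin n → E)) := by
  obtain ⟨u, hu⟩ := ht
  obtain ⟨Φ, hΦ⟩ := WeilGroup.deg_surjective IsFrobPow.mul_holds IsFrobPow.unique_holds
    (exists_isFrobPow_holds F) (-1 : ℤ)
  refine IsWeilDeligneOfLadic.of_N_eq_zero _ _ rfl t (WeilGroup.inertia F) le_rfl
    (WeilGroup.isOpen_inertia F) ⟨u, u.2, hu⟩ (fun _ _ => rfl) Φ hΦ fun m w => ?_
  rw [MonoidHom.one_apply, Units.val_one]
  exact LinearMap.toMatrix'_id

/-- **`rec_1` of the trivial character is the trivial class.**  For every local Langlands datum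
`L` of `F`, the trivial Weil–Deligne representation on `ℂ¹` has Frobenius-semisimple class
`rec_1(1 ∘ det)`: by `gl_one`, `rec_1(1 ∘ det) ≅ (1 ∘ artin, 0) ≅ (1, 0)`, a representation
isomorphic to the trivial one is trivial (`eq_trivial_of_isEquivalent_trivial`), and the trivial
representation is its own Frobenius-semisimplification. [cite: TateCorvallis1979, (4.1.3)]
[cite: HarrisTaylorAMS2001, Thm. A] -/
theorem hasFrobSemisimpleClass_trivial_recGL_one (L : LocalLanglandsDatum F) :
    (WeilDeligneRep.trivial ℂ (Fin 1 → ℂ) : WeilDeligneRep F ℂ (Fin 1 → ℂ)).HasFrobSemisimpleClass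
      (L.recGL 1 (IrrClass.mk (SmoothIrrep.ofQuasiChar (1 : QuasiChar F)))) := by
  set πv : SmoothIrrep (GL (Fin 1) F) := SmoothIrrep.ofQuasiChar 1 with hπv
  have hgl := L.isLocalLanglands.gl_one 1 πv (SmoothIrrep.ofQuasiChar_ρ_apply 1)
  have hq : (WeilDeligneRep.ofQuasiChar L.hns L.artin (1 : QuasiChar F)).IsEquivalent
      (WeilDeligneRep.trivial ℂ ℂ) :=
    ⟨{ toRepEquiv := Representation.Equiv.mk (LinearEquiv.refl ℂ ℂ) fun w => LinearMap.ext fun z => by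
        simp [WeilDeligneRep.trivial]
       comm_N := by simp [WeilDeligneRep.trivial] }⟩
  have hout : ((L.recGL 1 (IrrClass.mk πv)).out).1 = WeilDeligneRep.trivial ℂ (Fin 1 → ℂ) :=
    eq_trivial_of_isEquivalent_trivial (hgl.trans hq)
  refine ⟨((L.recGL 1 (IrrClass.mk πv)).out).1, ?_, Quotient.out_eq _⟩
  rw [hout]
  exact (isFrobSemisimple_trivial 1).isFrobSemisimplificationOf_self

end Local

/-! ## 2. The pair `(π_𝟙, 1)` over a number field -/

section Summit

variable {K : Type} [Field K] [NumberField K] {ℓ : ℕ} [Fact ℓ.Prime]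

/-- The restriction of `1 : Γ_K → GL_n(ℚ̄_ℓ)` to `W_{K_v}` is the trivial homomorphism. [folklore] -/
theorem toWeilGroupHom_toLocal_one (v : HeightOneSpectrum (𝓞 K)) (n : ℕ) :
    ((1 : FramedGaloisRep K (PadicAlgCl ℓ) n).toLocal v).toWeilGroupHom = 1 :=
  MonoidHom.ext fun _ => rfl

omit [NumberField K] in
/-- `1 : Γ_K → GL_n(ℚ̄_ℓ)` is unramified at every finite place. [folklore] -/
theorem isUnramifiedAt_one (v : HeightOneSpectrum (𝓞 K)) (n : ℕ) :
    (1 : FramedGaloisRep K (PadicAlgCl ℓ) n).IsUnramifiedAt v := fun _ _ _ _ => rfl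

variable {hcpt₁ : isCompact_glFiniteIntegralLevel 1 K} {π : AutomorphicRepData (AutomorphyDatum.gl 1 K hcpt₁)}

/-- **The local component of `π_𝟙` at `v` is the trivial character** `1 ∘ det` of `GL₁(K_v)` on
`ℂ` (`SmoothIrrep.ofQuasiChar 1`): the line `c ↦ c · (1 ∘ det)` is a local component map
(`W = ℂ · (1 ∘ det)`, `W' = ⊥`, right translation fixes `1 ∘ det`). [cite: BorelJacquet1979, 4.6] -/
theorem hasLocalComponentAt_trivial
    (hW : π.W = Submodule.span ℂ {fun g : (AdelicGroupData.gl 1 K).Adelic =>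
      (detTwist 1 (1 : HeckeCharacter K) g : ℂ)})
    (hW' : π.W' = ⊥) (v : HeightOneSpectrum (𝓞 K)) :
    π.HasLocalComponentAt v (SmoothIrrep.ofQuasiChar (1 : QuasiChar (v.adicCompletion K))).ρ := by
  classical
  have hd1 : ∀ h : (AdelicGroupData.gl 1 K).Adelic,
      ((detTwist 1 (1 : HeckeCharacter K) h : ℂˣ) : ℂ) = 1 := fun h => by
    rw [detTwist_apply, HeckeCharacter.one_apply, Units.val_one]
  show π.HasLocalComponentAt v (V := ℂ)
    (glOneRep ((1 : QuasiChar (v.adicCompletion K)) : (v.adicCompletion K)ˣ →* ℂˣ))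
  refine ⟨LinearMap.toSpanSingleton ℂ ((AdelicGroupData.gl 1 K).Adelic → ℂ)
    (fun g => (detTwist 1 (1 : HeckeCharacter K) g : ℂ)), ?_, ?_, fun g x => ?_⟩
  · rw [hW, LinearMap.span_singleton_eq_range]
  · rw [hW']
    intro hle
    have h := hle (LinearMap.mem_range_self _ (1 : ℂ))
    rw [LinearMap.toSpanSingleton_apply_one, Submodule.mem_bot] at h
    have h1 := congrFun h 1
    rw [hd1, Pi.zero_apply] at h1
    exact one_ne_zero h1
  · rw [hW', Submodule.mem_bot, LinearMap.toSpanSingleton_apply, LinearMap.toSpanSingleton_apply,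
      map_smul, rightTranslation_detTwist_glOne, hd1, one_smul, sub_eq_zero]
    change ((((1 : QuasiChar (v.adicCompletion K)) (Matrix.GeneralLinearGroup.det g) : ℂˣ) : ℂ) • x) • _ = _
    simp

/-- **Satake–Frobenius matching a.e. for `(π_𝟙, 1)`.**  Off a level `𝔪` of the trivial Hecke
character, `π_𝟙` has Satake parameter `{1(ϖ_v)} = {1}` at `v`
(`AutomorphicRepData.hasSatakeParamAt_detTwist_glOne`), `1` is unramified at `v`, and every
arithmetic Frobenius has characteristic polynomial `X - ι⁻¹(1⁻¹) = X - 1` on `1`.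
[cite: BuzzardGeeLMS2014, Conj. 3.2.1 and Rem. 3.2.5] [cite: BorelJacquet1979, 4.6] -/
theorem eventually_satakeFrobCompatibleAt_trivial
    (hW : π.W = Submodule.span ℂ {fun g : (AdelicGroupData.gl 1 K).Adelic =>
      (detTwist 1 (1 : HeckeCharacter K) g : ℂ)})
    (hW' : π.W' = ⊥) (ι : PadicAlgCl ℓ ≃+* ℂ) :
    ∀ᶠ v : HeightOneSpectrum (𝓞 K) in cofinite,
      SatakeFrobCompatibleAt ι π (1 : FramedGaloisRep K (PadicAlgCl ℓ) 1) v := by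
  classical
  obtain ⟨𝔪, h𝔪, hω𝔪⟩ := HeckeCharacter.exists_level_glOne (1 : HeckeCharacter K)
  filter_upwards [(Ideal.finite_factors h𝔪).compl_mem_cofinite] with v hv
  have hsat := AutomorphicRepData.hasSatakeParamAt_detTwist_glOne hcpt₁ hW hW' h𝔪 hω𝔪 v hv
    (HeckeCharacter.valued_uniformizer (K := K) v)
  have hsat1 : π.HasSatakeParamAt v {1} := by simpa using hsat
  refine ⟨{1}, hsat1, isUnramifiedAt_one v 1, ?_⟩
  rw [arithFrobPolyOfSatake_one, Multiset.map_singleton, Multiset.prod_singleton, inv_one, map_one]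
  exact (FramedGaloisRep.hasFrobCharpolyAt_iff_of_rank_one _ v 1).mpr fun _ _ _ _ => by simp

/-- **`(π_𝟙, 1)` is locally–globally compatible at every `v ∤ ℓ`, for EVERY reciprocity datum**,
granted a character `t : I_{K_v} →* ℚ̄_ℓ` not identically `1`: the local component of `π_𝟙` at `v`
is the trivial character, `rec_v` of it is the trivial class (`gl_one`), `r = rℂ =` the trivial
Weil–Deligne representation, and the Grothendieck–Deligne relation for `1|_{W_{K_v}}` and `(1, 0)`
is `isWeilDeligneOfLadic_one_trivial`. [cite: TateCorvallis1979, (4.1.3)–(4.2.1)]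
[cite: DeligneAntwerpII1973, §8.4.2] -/
theorem localGlobalCompatibleAt_trivial_away
    (hW : π.W = Submodule.span ℂ {fun g : (AdelicGroupData.gl 1 K).Adelic =>
      (detTwist 1 (1 : HeckeCharacter K) g : ℂ)})
    (hW' : π.W' = ⊥) (Rec : ReciprocityData K) (ι : PadicAlgCl ℓ ≃+* ℂ)
    (v : HeightOneSpectrum (𝓞 K)) (hv : ((ℓ : ℕ) : 𝓞 K) ∉ v.asIdeal)
    (t : WeilGroup.inertia (v.adicCompletion K) →* Multiplicative (PadicAlgCl ℓ))
    (ht : ∃ u : WeilGroup.inertia (v.adicCompletion K), t u ≠ 1) :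
    LocalGlobalCompatibleAt Rec ι π (1 : FramedGaloisRep K (PadicAlgCl ℓ) 1) v := by
  have hlad : IsWeilDeligneOfLadic
      (((1 : FramedGaloisRep K (PadicAlgCl ℓ) 1).toLocal v).toWeilGroupHom)
      (WeilDeligneRep.trivial (PadicAlgCl ℓ) (Fin 1 → PadicAlgCl ℓ)) := by
    rw [toWeilGroupHom_toLocal_one]
    exact isWeilDeligneOfLadic_one_trivial t ht
  exact ⟨SmoothIrrep.ofQuasiChar 1, WeilDeligneRep.trivial (PadicAlgCl ℓ) (Fin 1 → PadicAlgCl ℓ),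
    WeilDeligneRep.trivial ℂ (Fin 1 → ℂ), hasLocalComponentAt_trivial hW hW' v, fun _ => hlad,
    fun hv' => absurd hv' hv, isTransportAlong_trivial _,
    hasFrobSemisimpleClass_trivial_recGL_one (Rec.llc v)⟩

/-- **`(π_𝟙, 1)` corresponds, for EVERY reciprocity datum** (under `FontaineDatumExists`, granted
at every `v ∤ ℓ` a character of `I_{K_v}` with values in `ℚ̄_ℓ` not identically `1`): Satake
parameter `{1}` a.e. against `char(Frob_v) = X - 1` (`eventually_satakeFrobCompatibleAt_trivial`);
at `v ∣ ℓ` c3's `localGlobalCompatibleAt_trivial_above` ((F8) of Fontaine's specification); at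
`v ∤ ℓ` `localGlobalCompatibleAt_trivial_away`. [cite: TateCorvallis1979, (4.1.3)–(4.2.1)]
[cite: FontaineAsterisque223VIII, §1.3] -/
theorem corresponds_trivial (hF : FontaineDatumExists)
    (hW : π.W = Submodule.span ℂ {fun g : (AdelicGroupData.gl 1 K).Adelic =>
      (detTwist 1 (1 : HeckeCharacter K) g : ℂ)})
    (hW' : π.W' = ⊥) (Rec : ReciprocityData K) (ι : PadicAlgCl ℓ ≃+* ℂ)
    (hT : ∀ v : HeightOneSpectrum (𝓞 K), ((ℓ : ℕ) : 𝓞 K) ∉ v.asIdeal →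
      ∃ t : WeilGroup.inertia (v.adicCompletion K) →* Multiplicative (PadicAlgCl ℓ),
        ∃ u : WeilGroup.inertia (v.adicCompletion K), t u ≠ 1) :
    Corresponds Rec ι π (1 : FramedGaloisRep K (PadicAlgCl ℓ) 1) := by
  refine ⟨eventually_satakeFrobCompatibleAt_trivial hW hW' ι, fun v => ?_⟩
  by_cases hv : ((ℓ : ℕ) : 𝓞 K) ∈ v.asIdeal
  · exact localGlobalCompatibleAt_trivial_above hF hW hW' Rec ι v hv
  · obtain ⟨t, ht⟩ := hT v hv
    exact localGlobalCompatibleAt_trivial_away hW hW' Rec ι v hv t ht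

end Summit

/-- **Registered stub `stub_trivialPair_corresponds_of_inertiaCharacter` of line `Sketch` (crux
stmt-Langlands-14328, c4), closed form of `corresponds_trivial`.**  Under `FontaineDatumExists`, for
the trivial automorphic character `π_𝟙 = ℂ·(1 ∘ det)/⊥` of `GL₁(𝔸_K)` and the trivial
`ρ = 1 : Γ_K → GL₁(ℚ̄_ℓ)`, granted at every `v ∤ ℓ` a character of `I_{K_v}` with values in `ℚ̄_ℓ`
not identically `1`: `Corresponds Rec ι π_𝟙 1` for EVERY reciprocity datum `Rec` — the first
witnessed instance of the summit's correspondence predicate. [cite: TateCorvallis1979, (4.1.3)–(4.2.1)]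
[cite: FontaineAsterisque223VIII, §1.3] -/
theorem stub_trivialPair_corresponds_of_inertiaCharacter :
    FontaineDatumExists → ∀ (K : Type) [Field K] [NumberField K] (ℓ : ℕ) [Fact ℓ.Prime]
      (hcpt : isCompact_glFiniteIntegralLevel 1 K) (Rec : ReciprocityData K) (ι : PadicAlgCl ℓ ≃+* ℂ)
      (π : AutomorphicRepData (AutomorphyDatum.gl 1 K hcpt)),
      π.W = Submodule.span ℂ {fun g : (AdelicGroupData.gl 1 K).Adelic =>
        (detTwist 1 (1 : HeckeCharacter K) g : ℂ)} →
      π.W' = ⊥ →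
      (∀ v : HeightOneSpectrum (𝓞 K), ((ℓ : ℕ) : 𝓞 K) ∉ v.asIdeal →
        ∃ t : WeilGroup.inertia (v.adicCompletion K) →* Multiplicative (PadicAlgCl ℓ),
          ∃ u : WeilGroup.inertia (v.adicCompletion K), t u ≠ 1) →
      Corresponds Rec ι π (1 : FramedGaloisRep K (PadicAlgCl ℓ) 1) :=
  fun hF _ _ _ _ _ _ Rec ι _ hW hW' hT => corresponds_trivial hF hW hW' Rec ι hT

end Summit.Langlands.Langlands.Theorems.ReciprocityUpToIrreducibility

end
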